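import Literature.Topology.FourManifolds.RadialExtension
import Literature.Topology.FourManifolds.TubePacing
import HarnessLib

/-!
# The concatenated sphere family of the untwist zones

Topic `Literature/Topology/FourManifolds`; companion of `TubeUntwistFamily.lean` and
`TubeRadial.lean` (codimension `q = k + 1 ≥ 2` steps of the smoothing of PD homeomorphisms:
Munkres, Ann. of Math. 72 (1960), §§4–5; Campbell–D'Onofrio–Vítek, J. Geom. Anal. (2026), Lemma 3.2
Step 4 / Lemma 3.4 Step 3; Cerf (1968), Ch. I §1, Lemme 2).  The untwist zones below the rounding
zone read a single jointly smooth family of sphere maps `G : ℝ → E × 𝕊ᵏ → 𝕊ᵏ` going, as the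
family parameter `s` increases (i.e. outward), from a rigid map `R` (a reflection or the
identity — the **linear core**), through the stages of a diffeotopy `D` of `𝕊ᵏ` precomposed
with `R` (the **α-untwist**, CDV Lemma 3.2 Step 4), to the link map `ĥ(x₀, ·)` of the normal part
at a base point, and then through the **base-point contraction** `ĥ(x₀ + σ (x − x₀), ·)` to the
actual link family `ĥ(x, ·)`:

  `concatSphereFamily D R ĥ x₀ s (x, θ) =`
  `  if s ≤ 1 then D_{ramp₀ s} (R θ) else ĥ (x₀ + ramp₁ s • (x − x₀)) θ`,

`ramp₀ = rampCutoff 0 (1/2)`, `ramp₁ = rampCutoff (3/2) 2` (`TubePacing.lean`), so that near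
`s = 1` both branches are the `s`-constant map `ĥ(x₀, ·)` when `D_1 ∘ R = ĥ(x₀, ·)`.  We prove
the plateau identities, the **joint smoothness** of `uncurry (concatSphereFamily …)` on
`ℝ × (E × 𝕊ᵏ)` (`contMDiff_uncurry_concatSphereFamily`), and the **injectivity of the
differential of every stage** (`injective_mfderiv_concatSphereFamily_stage`) from that of `R`,
of the diffeotopy stages (automatic) and of the link stages — the two inputs `hG`, `hinj` of
`TubeUntwistFamily.lean`.  Definitions are explicit functions; no named facts.

## References

* J. R. Munkres, *Obstructions to the smoothing of piecewise-differentiable homeomorphisms*, Ann.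
  of Math. (2) 72 (1960), 521–554, §§4–5. [Munkres1960]
* D. Campbell, L. D'Onofrio, T. Vítek, *Diffeomorphic approximation of piecewise affine
  homeomorphisms*, J. Geom. Anal. 36 (2026), Lemma 3.2 (Step 4), Lemma 3.4 (Step 3).
  [CampbellDonofrioVitek2026]
* J. Cerf, *Sur les difféomorphismes de la sphère de dimension trois (Γ₄ = 0)*, LNM 53 (1968),
  Ch. I §1, Lemme 2. [CerfDiffeoSphere1968]
-/

noncomputable section

open Set Function Metric Module Filter
open scoped Manifold ContDiff Topology

namespace Literature.Topology.FourManifolds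

variable {k : ℕ} {E : Type*} [NormedAddCommGroup E] [NormedSpace ℝ E]

/-- **The concatenated sphere family** (core map `R` → diffeotopy `D ∘ R` → link at the base
point → base-point contraction → link family `ĥ`).
[cite: CampbellDonofrioVitek2026, Lemma 3.2 (Step 4)] -/
def concatSphereFamily (D : Diffeotopy (𝓡 k) (sphere (0 : EuclideanSpace ℝ (Fin (k + 1))) 1))
    (R : sphere (0 : EuclideanSpace ℝ (Fin (k + 1))) 1 → sphere (0 : EuclideanSpace ℝ (Fin (k + 1))) 1)
    (ĥ : E → sphere (0 : EuclideanSpace ℝ (Fin (k + 1))) 1 → sphere (0 : EuclideanSpace ℝ (Fin (k + 1))) 1)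
    (x₀ : E) (s : ℝ) (q : E × sphere (0 : EuclideanSpace ℝ (Fin (k + 1))) 1) :
    sphere (0 : EuclideanSpace ℝ (Fin (k + 1))) 1 :=
  if s ≤ 1 then D.toFun (rampCutoff 0 2⁻¹ s) (R q.2) else ĥ (x₀ + rampCutoff (3 / 2) 2 s • (q.1 - x₀)) q.2

variable {D : Diffeotopy (𝓡 k) (sphere (0 : EuclideanSpace ℝ (Fin (k + 1))) 1)}
  {R : sphere (0 : EuclideanSpace ℝ (Fin (k + 1))) 1 → sphere (0 : EuclideanSpace ℝ (Fin (k + 1))) 1}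
  {ĥ : E → sphere (0 : EuclideanSpace ℝ (Fin (k + 1))) 1 → sphere (0 : EuclideanSpace ℝ (Fin (k + 1))) 1}
  {x₀ : E}

/-! ### Plateau identities -/

/-- For `s ≤ 1` the family is the diffeotopy branch. [folklore] -/
theorem concatSphereFamily_of_le_one {s : ℝ} (hs : s ≤ 1) (q : E × sphere (0 : EuclideanSpace ℝ (Fin (k + 1))) 1) :
    concatSphereFamily D R ĥ x₀ s q = D.toFun (rampCutoff 0 2⁻¹ s) (R q.2) := by
  rw [concatSphereFamily, if_pos hs]

/-- For `1 < s` the family is the contraction branch. [folklore] -/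
theorem concatSphereFamily_of_one_lt {s : ℝ} (hs : 1 < s) (q : E × sphere (0 : EuclideanSpace ℝ (Fin (k + 1))) 1) :
    concatSphereFamily D R ĥ x₀ s q = ĥ (x₀ + rampCutoff (3 / 2) 2 s • (q.1 - x₀)) q.2 := by
  rw [concatSphereFamily, if_neg (not_le.2 hs)]

/-- **Core plateau**: for `s ≤ 0` the family is the rigid map `R`. [folklore] -/
theorem concatSphereFamily_of_nonpos {s : ℝ} (hs : s ≤ 0) (q : E × sphere (0 : EuclideanSpace ℝ (Fin (k + 1))) 1) :
    concatSphereFamily D R ĥ x₀ s q = R q.2 := by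
  rw [concatSphereFamily_of_le_one (hs.trans zero_le_one), rampCutoff_of_le (by norm_num) hs, D.toFun_zero, id]

/-- **Middle plateau**: for `1/2 ≤ s ≤ 3/2` the family is the link at the base point, provided
`D_1 ∘ R = ĥ(x₀, ·)`. [folklore] -/
theorem concatSphereFamily_of_mem_middle (hmatch : ∀ θ, D.toFun 1 (R θ) = ĥ x₀ θ) {s : ℝ}
    (hs₁ : 2⁻¹ ≤ s) (hs₂ : s ≤ 3 / 2) (q : E × sphere (0 : EuclideanSpace ℝ (Fin (k + 1))) 1) :
    concatSphereFamily D R ĥ x₀ s q = ĥ x₀ q.2 := by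
  by_cases hs : s ≤ 1
  · rw [concatSphereFamily_of_le_one hs, rampCutoff_of_ge (by norm_num) hs₁, hmatch]
  · rw [concatSphereFamily_of_one_lt (not_le.1 hs), rampCutoff_of_le (by norm_num) hs₂, zero_smul, add_zero]

/-- **Outer plateau**: for `2 ≤ s` the family is the link family `ĥ(x, ·)`. [folklore] -/
theorem concatSphereFamily_of_two_le {s : ℝ} (hs : 2 ≤ s) (q : E × sphere (0 : EuclideanSpace ℝ (Fin (k + 1))) 1) :
    concatSphereFamily D R ĥ x₀ s q = ĥ q.1 q.2 := by
  rw [concatSphereFamily_of_one_lt (by linarith), rampCutoff_of_ge (by norm_num) hs, one_smul, add_sub_cancel]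

/-- The contraction point `x₀ + ramp₁ s • (x − x₀)` lies on the segment `[x₀, x]`. [folklore] -/
theorem concat_basePoint_mem_segment (s : ℝ) (x : E) :
    x₀ + rampCutoff (3 / 2) 2 s • (x - x₀) ∈ segment ℝ x₀ x := by
  have h := rampCutoff_mem_Icc (3 / 2 : ℝ) 2 s
  refine ⟨1 - rampCutoff (3 / 2) 2 s, rampCutoff (3 / 2) 2 s, by linarith [h.2], h.1, by ring, ?_⟩
  simp only [smul_sub, sub_smul, one_smul]
  abel

/-! ### Joint smoothness -/

/-- **The concatenated family is jointly smooth** on `ℝ × (E × 𝕊ᵏ)` if `R` is smooth, `ĥ` is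
jointly smooth on `E × 𝕊ᵏ` and the branches match: `D_1 ∘ R = ĥ(x₀, ·)`. [folklore] -/
theorem contMDiff_uncurry_concatSphereFamily (hR : ContMDiff (𝓡 k) (𝓡 k) ∞ R)
    (hĥ : ContMDiff (𝓘(ℝ, E).prod (𝓡 k)) (𝓡 k) ∞ (uncurry ĥ))
    (hmatch : ∀ θ, D.toFun 1 (R θ) = ĥ x₀ θ) :
    ContMDiff (𝓘(ℝ, ℝ).prod (𝓘(ℝ, E).prod (𝓡 k))) (𝓡 k) ∞ (uncurry (concatSphereFamily D R ĥ x₀)) := by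
  intro sq
  obtain ⟨s, q⟩ := sq
  -- the two branches as globally smooth maps of `(s, q)`
  have hbr₁ : ContMDiff (𝓘(ℝ, ℝ).prod (𝓘(ℝ, E).prod (𝓡 k))) (𝓡 k) ∞
      (fun p : ℝ × (E × sphere (0 : EuclideanSpace ℝ (Fin (k + 1))) 1) =>
        D.toFun (rampCutoff 0 2⁻¹ p.1) (R p.2.2)) := by
    have h1 : ContMDiff (𝓘(ℝ, ℝ).prod (𝓘(ℝ, E).prod (𝓡 k))) (𝓘(ℝ, ℝ).prod (𝓡 k)) ∞
        (fun p : ℝ × (E × sphere (0 : EuclideanSpace ℝ (Fin (k + 1))) 1) =>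
          (rampCutoff 0 2⁻¹ p.1, R p.2.2)) :=
      (((contDiff_rampCutoff 0 2⁻¹).contMDiff).comp contMDiff_fst).prodMk
        (hR.comp (contMDiff_snd.comp contMDiff_snd))
    exact D.contMDiff_uncurry_toFun.comp h1
  have hbr₂ : ContMDiff (𝓘(ℝ, ℝ).prod (𝓘(ℝ, E).prod (𝓡 k))) (𝓡 k) ∞
      (fun p : ℝ × (E × sphere (0 : EuclideanSpace ℝ (Fin (k + 1))) 1) =>
        ĥ (x₀ + rampCutoff (3 / 2) 2 p.1 • (p.2.1 - x₀)) p.2.2) := by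
    have hx : ContMDiff (𝓘(ℝ, ℝ).prod (𝓘(ℝ, E).prod (𝓡 k))) 𝓘(ℝ, E) ∞
        (fun p : ℝ × (E × sphere (0 : EuclideanSpace ℝ (Fin (k + 1))) 1) =>
          x₀ + rampCutoff (3 / 2) 2 p.1 • (p.2.1 - x₀)) := by
      have hs : ContMDiff (𝓘(ℝ, ℝ).prod (𝓘(ℝ, E).prod (𝓡 k))) 𝓘(ℝ, ℝ) ∞
          (fun p : ℝ × (E × sphere (0 : EuclideanSpace ℝ (Fin (k + 1))) 1) =>
            rampCutoff (3 / 2) 2 p.1) :=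
        ((contDiff_rampCutoff (3 / 2) 2).contMDiff).comp contMDiff_fst
      have hx1 : ContMDiff (𝓘(ℝ, ℝ).prod (𝓘(ℝ, E).prod (𝓡 k))) 𝓘(ℝ, E) ∞
          (fun p : ℝ × (E × sphere (0 : EuclideanSpace ℝ (Fin (k + 1))) 1) => p.2.1 - x₀) :=
        (contMDiff_fst.comp contMDiff_snd).sub contMDiff_const
      exact contMDiff_const.add (hs.smul hx1)
    exact hĥ.comp (hx.prodMk (contMDiff_snd.comp contMDiff_snd))
  -- case analysis on `s`
  rcases lt_trichotomy s 1 with hs | rfl | hs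
  · refine (hbr₁ (s, q)).congr_of_eventuallyEq ?_
    have ho : IsOpen {p : ℝ × (E × sphere (0 : EuclideanSpace ℝ (Fin (k + 1))) 1) | p.1 < 1} :=
      isOpen_lt continuous_fst continuous_const
    filter_upwards [ho.mem_nhds hs] with p hp
    exact concatSphereFamily_of_le_one (le_of_lt hp) p.2
  · -- near `s = 1` the family is `ĥ x₀ ∘ snd ∘ snd`
    have hmid : ContMDiff (𝓘(ℝ, ℝ).prod (𝓘(ℝ, E).prod (𝓡 k))) (𝓡 k) ∞
        (fun p : ℝ × (E × sphere (0 : EuclideanSpace ℝ (Fin (k + 1))) 1) => ĥ x₀ p.2.2) :=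
      hĥ.comp (contMDiff_const.prodMk (contMDiff_snd.comp contMDiff_snd))
    refine (hmid (1, q)).congr_of_eventuallyEq ?_
    have ho : IsOpen {p : ℝ × (E × sphere (0 : EuclideanSpace ℝ (Fin (k + 1))) 1) |
        2⁻¹ < p.1 ∧ p.1 < 3 / 2} :=
      (isOpen_lt continuous_const continuous_fst).inter (isOpen_lt continuous_fst continuous_const)
    filter_upwards [ho.mem_nhds ⟨by norm_num, by norm_num⟩] with p hp
    exact concatSphereFamily_of_mem_middle hmatch hp.1.le hp.2.le p.2
  · refine (hbr₂ (s, q)).congr_of_eventuallyEq ?_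
    have ho : IsOpen {p : ℝ × (E × sphere (0 : EuclideanSpace ℝ (Fin (k + 1))) 1) | 1 < p.1} :=
      isOpen_lt continuous_const continuous_fst
    filter_upwards [ho.mem_nhds hs] with p hp
    exact concatSphereFamily_of_one_lt hp p.2

/-! ### Injectivity of the stage differentials -/

/-- The stages of a diffeotopy have injective differential (left inverse `D_t⁻¹`). [folklore] -/
theorem injective_mfderiv_diffeotopy_toFun (D : Diffeotopy (𝓡 k) (sphere (0 : EuclideanSpace ℝ (Fin (k + 1))) 1))
    (t : ℝ) (θ : sphere (0 : EuclideanSpace ℝ (Fin (k + 1))) 1) :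
    Injective (mfderiv (𝓡 k) (𝓡 k) (D.toFun t) θ) := by
  haveI : Fact (finrank ℝ (EuclideanSpace ℝ (Fin (k + 1))) = k + 1) := ⟨finrank_euclideanSpace_fin⟩
  have hF : MDifferentiableAt (𝓡 k) (𝓡 k) (D.toFun t) θ := (D.contMDiff_toFun t).mdifferentiableAt (by simp)
  have hG : MDifferentiableAt (𝓡 k) (𝓡 k) (D.invFun t) (D.toFun t θ) :=
    (D.contMDiff_invFun t).mdifferentiableAt (by simp)
  have hcomp : (mfderiv (𝓡 k) (𝓡 k) (D.invFun t) (D.toFun t θ)).comp (mfderiv (𝓡 k) (𝓡 k) (D.toFun t) θ) =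
      ContinuousLinearMap.id ℝ _ := by
    rw [← mfderiv_comp θ hG hF]
    have : (D.invFun t ∘ D.toFun t) = id := funext (D.invFun_toFun t)
    rw [this, mfderiv_id]
  intro v w hvw
  have := congrArg (mfderiv (𝓡 k) (𝓡 k) (D.invFun t) (D.toFun t θ)) hvw
  rw [← ContinuousLinearMap.comp_apply, ← ContinuousLinearMap.comp_apply, hcomp] at this
  exact this

/-- **Every stage of the concatenated family has injective differential**, provided `R` is
smooth with injective differential and every link stage `ĥ x` (for `x` on the segments
`[x₀, x]`, e.g. all `x` of a star-shaped domain) has injective differential. [folklore] -/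
theorem injective_mfderiv_concatSphereFamily_stage (hR : ContMDiff (𝓡 k) (𝓡 k) ∞ R)
    (hRinj : ∀ θ, Injective (mfderiv (𝓡 k) (𝓡 k) R θ))
    (hĥinj : ∀ (x : E) (θ : sphere (0 : EuclideanSpace ℝ (Fin (k + 1))) 1),
      Injective (mfderiv (𝓡 k) (𝓡 k) (ĥ x) θ))
    (s : ℝ) (x : E) (θ : sphere (0 : EuclideanSpace ℝ (Fin (k + 1))) 1) :
    Injective (mfderiv (𝓡 k) (𝓡 k) (fun θ' => concatSphereFamily D R ĥ x₀ s (x, θ')) θ) := by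
  haveI : Fact (finrank ℝ (EuclideanSpace ℝ (Fin (k + 1))) = k + 1) := ⟨finrank_euclideanSpace_fin⟩
  by_cases hs : s ≤ 1
  · have hfun : (fun θ' => concatSphereFamily D R ĥ x₀ s (x, θ')) =
        D.toFun (rampCutoff 0 2⁻¹ s) ∘ R := funext fun θ' => concatSphereFamily_of_le_one hs (x, θ')
    rw [hfun, mfderiv_comp θ ((D.contMDiff_toFun _).mdifferentiableAt (by simp))
      (hR.mdifferentiableAt (by simp))]
    exact (injective_mfderiv_diffeotopy_toFun D _ _).comp (hRinj θ)
  · have hfun : (fun θ' => concatSphereFamily D R ĥ x₀ s (x, θ')) =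
        ĥ (x₀ + rampCutoff (3 / 2) 2 s • (x - x₀)) :=
      funext fun θ' => concatSphereFamily_of_one_lt (not_le.1 hs) (x, θ')
    rw [hfun]
    exact hĥinj _ θ

end Literature.Topology.FourManifolds
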